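import Literature.NumberTheory.EllipticCurves.GreenbergVatsal2000.GreenbergSelmerGroups
import Literature.NumberTheory.EllipticCurves.IwasawaSelmerProofs
import Literature.NumberTheory.EllipticCurves.H1CorestrictionIndexTwo
import Literature.NumberTheory.EllipticCurves.PeriodIndexCorestrictionLocal
import Literature.NumberTheory.EllipticCurves.CyclotomicZpExtension
import Literature.NumberTheory.EllipticCurves.ZpExtension
import Literature.NumberTheory.GaloisRepresentations.LocalGaloisGroupProofs
import Literature.NumberTheory.GaloisRepresentations.LocalGaloisGroupFrobeniusProofs
import Literature.NumberTheory.GaloisRepresentations.AbsGaloisGroupCompact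
import Literature.NumberTheory.GaloisRepresentations.DecompositionGroupOfCompletion
import Literature.NumberTheory.GaloisRepresentations.CyclotomicCharacterFrobeniusProofs
import Literature.NumberTheory.Automorphic.AdicCompletionResidueCard
import Mathlib.NumberTheory.Padics.RingHoms
import HarnessLib

/-!
# The unramified condition at `v` over a `ℤ_p`-extension: finitely many conjugates suffice
# (finitely many places of `K_∞` above a finitely decomposed `v`; Greenberg–Vatsal 2000 §2 p. 21)

HONEST FRAMING (cell `b2b-bsdres`, run/shared/lean/b2b/bsd-rank1-residual/, verbatim in every
file): the goal of the cell is to DELETE the COMBINATION-SHAPED residual classes of the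
Birch–Swinnerton-Dyer formula for ALL analytic-rank `≤ 1` elliptic curves over `ℚ` — "full BSD
formula for every rank `≤ 1` curve in class `C`" assembled STRICTLY from published theorems — so
that the rank-`≤ 1` remainder becomes exactly the CONSTRUCTION-SHAPED classes, which are TYPED
(missing-input `Prop`s), NOT attempted. This is not "finishing BSD". Team n1011 (N10/N11; row
T-GV23-PA = the located gap P-α of the A240 derivation): research routes on CONSTRUCTION-SHAPED
classes; prove what is provable now; no claim beyond stated classes; census output = EVIDENCE,
never a Literature fact; RESIDUAL-MAP marks UNCHANGED; nothing is booked by this file. TOOL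
THEOREMS ONLY: no definition, no named fact, nothing cited enters as a hypothesis.

## What

In the tree's place-by-place formalism (`GreenbergVatsal2000.GreenbergSelmerGroups`) the condition
"unramified at every place of `L = K̄^H` above `v`" on a class `c ∈ H¹(H, M)` is
`∀ σ : Γ_K, conj_σ c ∈ unramifiedKer H M v` — one condition per `σ`, although it only depends on
the place `σ` singles out. This file proves the reduction to FINITELY many `σ` over a
`ℤ_p`-extension `κ` (`H = ker κ`) at a finitely decomposed `v`:

* `conjH1_mem_unramifiedKer_of_mem_decomp` (§1): the condition set is invariant under LEFT
  multiplication by the decomposition group `D_v` (cocycle computation: `δ ∈ D_v` normalises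
  `H ⊓ I_v`, and `(δ·f)(j) = j • (δ • m) - δ • m` on `H ⊓ I_v` when `f = ∂m` there);
* `conjH1_mul_of_mem_left` (§1): and under left multiplication by `H` (inner automorphisms act
  trivially, `conjH1_of_mem_holds`);
* `exists_forall_eq_mul_decomp_mul_pow` (§2): if `κ(D_v) ≠ 1` — i.e. `v` is finitely decomposed in
  `K_∞` — then for some `m`, EVERY `σ ∈ Γ_K` is `h · δ · γⁿ` with `h ∈ H`, `δ ∈ D_v`, `n < p^m`, `γ`
  a topological generator (`κ(D_v)` is a closed subgroup of `ℤ_p` containing `κ δ₀ ≠ 0`, hence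
  `⊇ ‖·‖ ≤ ‖κ δ₀‖`, by density of `ℤ`; `n = PadicInt.appr`); GV 2000 p. 21: "`s_ℓ` … the number of
  primes of `ℚ_∞` lying over `ℓ` … the largest power of `p` such that `ℓ^{p-1} ≡ 1 (mod p s_ℓ)`";
* **`forall_conjH1_mem_unramifiedKer_of_forall_lt`** (§2): hence `conj_{γⁿ} c ∈ unramifiedKer`
  for `n < p^m` implies it for all `σ`;
* `exists_mem_decomp_apply_ne_one_of_isCyclotomic` (§3, `K : Type`): for the CYCLOTOMIC `κ`
  and `v ∤ p` the hypothesis holds — the restriction of a local Frobenius lies in `D_v` and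
  `χ_p(Frob_v) = N v` has infinite order (`GaloisRep.cyclotomicCharacter_frob_not_isOfFinOrder`),
  so it is not in `χ_p⁻¹(μ(ℤ_p)) = ker κ`. (For a general `κ` the hypothesis may FAIL — inert
  primes split completely in the anticyclotomic tower — and is displayed, not hidden.)

Consumer: the sibling `DatumSelmerLocalIndexFinite` (the `p`-torsion of `S^{Σ₀}/S` is finite).

References: R. Greenberg, V. Vatsal, Invent. Math. 142 (2000) §2 pp. 17, 21 (arXiv:math/9906215);
J.-P. Serre, *Local Fields*, VII §5 (conjugation on cohomology); L. Washington, *Introduction to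
Cyclotomic Fields*, §13.1.
-/

noncomputable section

open scoped Classical
open NumberField IsDedekindDomain Field CategoryTheory
open Literature.NumberTheory.GaloisRepresentations Literature.NumberTheory.EllipticCurves
  Literature.NumberTheory.EllipticCurves.GreenbergSelmer
  Literature.NumberTheory.EllipticCurves.GreenbergVatsal2000

universe u

namespace Summit.BirchSwinnertonDyer.Rank1Residual.Iwasawa

/-! ## §1. Invariance of the unramified condition under `D_v` and `H` -/

section Invariance

variable {K : Type u} [Field K] [NumberField K] (H : Subgroup (absoluteGaloisGroup K)) [H.Normal]
  (M : Type u) [AddCommGroup M] [DistribMulAction (absoluteGaloisGroup K) M] [TopologicalSpace M]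
  [DiscreteTopology M] {v : HeightOneSpectrum (𝓞 K)}

/-- `D_v` normalises `H ⊓ I_v`: for `δ ∈ D_v` and `j ∈ H ⊓ I_v`, `δ⁻¹ j δ ∈ D_v` lies in `H` (normal)
and in `I_v = res (I_{K_v})` (`absInertia K_v` is normal in `Γ_{K_v}`, `absInertia_normal_holds`).
[folklore] -/
theorem conj_mem_inertiaIn {δ : absoluteGaloisGroup K} (hδ : δ ∈ decomp v) (j : inertiaIn H v) :
    ∃ j' : inertiaIn H v,
      ((j' : decomp (K := K) v) : absoluteGaloisGroup K) =
        δ⁻¹ * ((j : decomp (K := K) v) : absoluteGaloisGroup K) * δ := by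
  obtain ⟨hjH, hjI⟩ := (mem_inertiaIn_iff H v (j : decomp (K := K) v)).1 j.2
  have hD : δ⁻¹ * ((j : decomp (K := K) v) : absoluteGaloisGroup K) * δ ∈ decomp (K := K) v :=
    (decomp v).mul_mem ((decomp v).mul_mem ((decomp v).inv_mem hδ) (j : decomp (K := K) v).2) hδ
  have hH : δ⁻¹ * ((j : decomp (K := K) v) : absoluteGaloisGroup K) * δ ∈ H :=
    Subgroup.Normal.conj_mem' inferInstance _ hjH δ
  have hI : δ⁻¹ * ((j : decomp (K := K) v) : absoluteGaloisGroup K) * δ ∈ inertia (K := K) v := by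
    obtain ⟨d, rfl⟩ := (mem_decomp_iff v δ).1 hδ
    obtain ⟨i, hi, hij⟩ := Subgroup.mem_map.1 hjI
    refine Subgroup.mem_map.2 ⟨d⁻¹ * i * d, (absInertia_normal_holds _).conj_mem' i hi d, ?_⟩
    rw [← hij, map_mul, map_mul, map_inv]
    rfl
  exact ⟨⟨⟨_, hD⟩, (mem_inertiaIn_iff H v _).2 ⟨hH, hI⟩⟩, rfl⟩

/-- **The unramified condition at `v` is invariant under left multiplication by `D_v`**: if
`c ∈ H¹(H, M)` restricts to `0` on `H ⊓ I_v`, so does `conj_δ c` for every `δ ∈ D_v`. On cocycles: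
if `f = ∂m` on `H ⊓ I_v` then `(δ·f)(j) = δ • f(δ⁻¹ j δ) = j • (δ • m) - δ • m` there.
Serre, *Local Fields*, VII §5; GV 2000 §2 p. 17 (the condition `[σ|_{I_η}] = 0` at each `η ∣ ℓ`).
[cite: GreenbergVatsal2000, §2 p. 17] -/
theorem conjH1_mem_unramifiedKer_of_mem_decomp {δ : absoluteGaloisGroup K} (hδ : δ ∈ decomp v)
    {c : subgroupH1 H M} (hc : c ∈ unramifiedKer H M v) :
    conjH1 H M δ c ∈ unramifiedKer H M v := by
  obtain ⟨f, rfl⟩ := oneCocycleClass_surjective _ c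
  rw [GreenbergVatsal2000.unramifiedKer, AddMonoidHom.mem_ker, resH1Hom_oneCocycleClass,
    oneCocycleClass_eq_zero_iff] at hc
  obtain ⟨m, hm⟩ := hc
  rw [GreenbergVatsal2000.unramifiedKer, AddMonoidHom.mem_ker, conjH1_oneCocycleClass,
    resH1Hom_oneCocycleClass, oneCocycleClass_eq_zero_iff]
  refine ⟨δ • m, fun j ↦ ?_⟩
  obtain ⟨j', hj'⟩ := conj_mem_inertiaIn H hδ j
  have hconj : subgroupConj H δ (inertiaInToH H v j) = inertiaInToH H v j' :=
    Subtype.ext (by rw [subgroupConj_apply_coe]; exact hj'.symm)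
  have hmj := hm j'
  rw [pullback_resHomOfEquivariant_apply, AddMonoidHom.id_apply] at hmj
  rw [pullback_resHomOfEquivariant_apply, AddMonoidHom.id_apply, conjCocycle_apply, hconj, hmj]
  change δ • (((j' : decomp (K := K) v) : absoluteGaloisGroup K) • m - m) =
    ((j : decomp (K := K) v) : absoluteGaloisGroup K) • (δ • m) - δ • m
  rw [hj', smul_sub, smul_smul, ← mul_assoc, ← mul_assoc, mul_inv_cancel, one_mul, mul_smul]

omit [NumberField K] in
/-- **Left multiplication by `H` does not change `conj`** on `H¹(H, M)`: `conj_{hσ} = conj_h ∘ conj_σ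
= conj_σ` (inner automorphisms act trivially, `conjH1_of_mem_holds`). Serre, *Local Fields*,
VII §5 Prop. 3. [cite: SerreLocalFields1979, VII.§5 Prop. 3] -/
theorem conjH1_mul_of_mem_left {h σ : absoluteGaloisGroup K} (hh : h ∈ H) (c : subgroupH1 H M) :
    conjH1 H M (h * σ) c = conjH1 H M σ c := by
  rw [conjH1_mul_holds H M h σ, AddMonoidHom.comp_apply, conjH1_of_mem_holds H M hh,
    AddMonoidHom.id_apply]

end Invariance

/-! ## §2. Over a `ℤ_p`-extension: `Γ_K = H · D_v · {γⁿ : n < p^m}` at a finitely decomposed `v` -/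

section Representatives

variable {K : Type u} [Field K] [NumberField K] {p : ℕ} [Fact p.Prime] (κ : ZpExtension K p)
  {v : HeightOneSpectrum (𝓞 K)}

/-- The image `κ(D_v) ⊆ ℤ_p` contains every `y` with `‖y‖ ≤ ‖κ δ₀‖`, for any `δ₀ ∈ D_v` with
`κ δ₀ ≠ 1`: it is closed (continuous image of the compact `Γ_{K_v}`), contains `ℤ · κ δ₀`, hence
its closure `ℤ_p · κ δ₀` (`PadicInt.denseRange_intCast`), which is that ball (`ℤ_p` is a DVR).
Washington §13.1 (closed subgroups of `ℤ_p` are `0` or `pⁿ ℤ_p`). [folklore] -/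
theorem exists_mem_decomp_apply_eq_of_norm_le {δ₀ : absoluteGaloisGroup K} (hδ₀ : δ₀ ∈ decomp v)
    (hne : κ δ₀ ≠ 1) {y : ℤ_[p]} (hy : ‖y‖ ≤ ‖(κ δ₀).toAdd‖) :
    ∃ δ ∈ decomp (K := K) v, κ δ = Multiplicative.ofAdd y := by
  haveI : CompactSpace (absoluteGaloisGroup (v.adicCompletion K)) :=
    absoluteGaloisGroup_compactSpace (v.adicCompletion K)
  set a : ℤ_[p] := (κ δ₀).toAdd with ha
  have ha0 : a ≠ 0 := fun h ↦ hne (by rw [← ofAdd_toAdd (κ δ₀), ← ha, h]; rfl)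
  -- the image of the local Galois group, as a closed subset of `ℤ_p`
  let f : absoluteGaloisGroup (v.adicCompletion K) → ℤ_[p] := fun d ↦
    (κ (absGaloisRestrict K (v.adicCompletion K) d)).toAdd
  have hf : Continuous f :=
    continuous_toAdd.comp ((map_continuous κ).comp
      (absGaloisRestrict K (v.adicCompletion K)).continuous_toFun)
  have hcl : IsClosed (Set.range f) := (isCompact_range hf).isClosed
  -- it contains `a · ℤ_p`
  obtain ⟨d₀, rfl⟩ := (mem_decomp_iff v δ₀).1 hδ₀
  have hmul : ∀ z : ℤ_[p], a * z ∈ Set.range f := by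
    have hT : IsClosed {z : ℤ_[p] | a * z ∈ Set.range f} :=
      hcl.preimage (continuous_const.mul continuous_id)
    have hZ : Set.range (Int.cast : ℤ → ℤ_[p]) ⊆ {z : ℤ_[p] | a * z ∈ Set.range f} := by
      rintro _ ⟨k, rfl⟩
      refine ⟨d₀ ^ k, ?_⟩
      change (κ (absGaloisRestrict K (v.adicCompletion K) (d₀ ^ k))).toAdd = a * k
      rw [map_zpow, map_zpow, toAdd_zpow, ha, mul_comm, zsmul_eq_mul]
    have huniv : {z : ℤ_[p] | a * z ∈ Set.range f} = Set.univ := by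
      refine Set.eq_univ_of_univ_subset ?_
      rw [← (PadicInt.denseRange_intCast (p := p)).closure_range]
      exact hT.closure_subset_iff.2 hZ
    intro z
    have hz : z ∈ {z : ℤ_[p] | a * z ∈ Set.range f} := by rw [huniv]; exact Set.mem_univ z
    exact hz
  -- `y = a z`
  obtain ⟨z, rfl⟩ := Literature.NumberTheory.EllipticCurves.PadicOneUnits.dvd_of_norm_le ha0 hy
  obtain ⟨d, hd⟩ := hmul z
  exact ⟨absGaloisRestrict K (v.adicCompletion K) d, ⟨d, rfl⟩, by
    rw [← ofAdd_toAdd (κ _)]; exact congrArg Multiplicative.ofAdd hd⟩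

/-- **`Γ_K = H · D_v · {γⁿ : n < p^m}`**: over a `ℤ_p`-extension `κ` with topological generator
`γ`, if some `δ₀ ∈ D_v` has `κ δ₀ ≠ 1` (i.e. `v` is finitely decomposed in `K_∞/K`), then for some
`m` every `σ ∈ Γ_K` factors as `σ = h · (δ · γⁿ)` with `h ∈ H = ker κ`, `δ ∈ D_v`, `n < p^m`
(`n = PadicInt.appr (κ σ) m`, `m` the valuation of `κ δ₀`). GV 2000 §2 p. 21 (`s_ℓ` = the number of
primes of `ℚ_∞` above `ℓ`, a power of `p`); Washington §13.1. [cite: GreenbergVatsal2000, §2 p. 21] -/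
theorem exists_forall_eq_mul_decomp_mul_pow {γ : absoluteGaloisGroup K} (hγ : κ.IsTopGenerator γ)
    {δ₀ : absoluteGaloisGroup K} (hδ₀ : δ₀ ∈ decomp v) (hne : κ δ₀ ≠ 1) :
    ∃ m : ℕ, ∀ σ : absoluteGaloisGroup K, ∃ n < p ^ m, ∃ δ ∈ decomp (K := K) v, ∃ h ∈ κ.kerSubgroup,
      σ = h * (δ * γ ^ n) := by
  set a : ℤ_[p] := (κ δ₀).toAdd with ha
  have ha0 : a ≠ 0 := fun h ↦ hne (by rw [← ofAdd_toAdd (κ δ₀), ← ha, h]; rfl)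
  refine ⟨a.valuation, fun σ ↦ ?_⟩
  set x : ℤ_[p] := (κ σ).toAdd with hx
  refine ⟨x.appr a.valuation, PadicInt.appr_lt x _, ?_⟩
  -- `x - appr x m` lies in the ball `‖·‖ ≤ ‖a‖ = p^{-m}`, hence in `κ(D_v)`
  have hy : ‖x - (x.appr a.valuation : ℤ_[p])‖ ≤ ‖a‖ := by
    rw [PadicInt.norm_eq_zpow_neg_valuation ha0, PadicInt.norm_le_pow_iff_mem_span_pow]
    exact PadicInt.appr_spec _ x
  obtain ⟨δ, hδ, hκδ⟩ := exists_mem_decomp_apply_eq_of_norm_le κ hδ₀ hne hy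
  refine ⟨δ, hδ, σ * (δ * γ ^ (x.appr a.valuation))⁻¹, ?_, by rw [inv_mul_cancel_right]⟩
  rw [ZpExtension.mem_kerSubgroup, map_mul, map_inv, map_mul, map_pow, hκδ, hγ,
    mul_inv_eq_one, ← ofAdd_toAdd (κ σ), ← hx, ← ofAdd_nsmul, ← ofAdd_add, nsmul_one,
    sub_add_cancel]

variable (M : Type u) [AddCommGroup M] [DistribMulAction (absoluteGaloisGroup K) M]
  [TopologicalSpace M] [DiscreteTopology M]

/-- **Finitely many conjugates suffice for the unramified condition at `v` over `K_∞`**: given the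
factorisation `σ = h · δ · γⁿ` (`h ∈ H`, `δ ∈ D_v`, `n < N`) of every `σ ∈ Γ_K`
(`exists_forall_eq_mul_decomp_mul_pow`), a class `c ∈ H¹(H, M)` with `conj_{γⁿ} c` unramified at
the chosen place above `v` for all `n < N` is unramified at EVERY place of `K_∞` above `v`
(`∀ σ, conj_σ c ∈ unramifiedKer H M v`) — §1. GV 2000 §2 pp. 16–17, 21 (`𝓗_ℓ(ℚ_∞) = ∏_{η∣ℓ}
H¹((ℚ_∞)_η, A)`, a finite product). [cite: GreenbergVatsal2000, §2 pp. 17, 21] -/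
theorem forall_conjH1_mem_unramifiedKer_of_forall_lt {γ : absoluteGaloisGroup K} {N : ℕ}
    (hrep : ∀ σ : absoluteGaloisGroup K, ∃ n < N, ∃ δ ∈ decomp (K := K) v, ∃ h ∈ κ.kerSubgroup,
      σ = h * (δ * γ ^ n))
    {c : subgroupH1 κ.kerSubgroup M}
    (hc : ∀ n < N, conjH1 κ.kerSubgroup M (γ ^ n) c ∈ unramifiedKer κ.kerSubgroup M v)
    (σ : absoluteGaloisGroup K) : conjH1 κ.kerSubgroup M σ c ∈ unramifiedKer κ.kerSubgroup M v := by
  haveI : κ.kerSubgroup.Normal := by rw [ZpExtension.kerSubgroup]; infer_instance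
  obtain ⟨n, hn, δ, hδ, h, hh, rfl⟩ := hrep σ
  rw [conjH1_mul_of_mem_left κ.kerSubgroup M hh, conjH1_mul_holds κ.kerSubgroup M δ (γ ^ n),
    AddMonoidHom.comp_apply]
  exact conjH1_mem_unramifiedKer_of_mem_decomp κ.kerSubgroup M hδ (hc n hn)

end Representatives

/-! ## §3. The cyclotomic `ℤ_p`-extension: `κ(D_v) ≠ 1` for `v ∤ p` -/

section Cyclotomic

variable {K : Type} [Field K] [NumberField K] {p : ℕ} [Fact p.Prime] {κ : ZpExtension K p}

/-- **In the CYCLOTOMIC `ℤ_p`-extension every `v ∤ p` is finitely decomposed**: some `δ ∈ D_v` has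
`κ δ ≠ 1`. Take `δ = res τ` for a Frobenius `τ` of `K_v` (`exists_isAbsArithFrob_holds`); it is an
arithmetic Frobenius at the prime `𝔓₀` cut out by the chosen embedding
(`isArithFrobAt_absGaloisRestrict_adicCompletionPrime_iff`), so `χ_p(δ) = N v` has infinite order
(`GaloisRep.cyclotomicCharacter_frob_not_isOfFinOrder`) and `δ ∉ χ_p⁻¹(μ(ℤ_p)) = ker κ`
(`ZpExtension.IsCyclotomic`). Washington §13.1; Serre, *Abelian ℓ-adic representations*, I-1.2.
(Stated for `K : Type`, the universe of the tree's Frobenius-value theorem.)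
[cite: Washington1997, §13.1] -/
theorem exists_mem_decomp_apply_ne_one_of_isCyclotomic (hκ : κ.IsCyclotomic)
    {v : HeightOneSpectrum (𝓞 K)} (hpv : (p : 𝓞 K) ∉ v.asIdeal) :
    ∃ δ ∈ decomp (K := K) v, κ δ ≠ 1 := by
  obtain ⟨τ, hτ⟩ := exists_isAbsArithFrob_holds (F := v.adicCompletion K)
  refine ⟨absGaloisRestrict K (v.adicCompletion K) τ, ⟨τ, rfl⟩, fun h1 ↦ ?_⟩
  have hq : IsNonarchimedeanLocalField.residueFieldCard (v.adicCompletion K) =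
      Nat.card (𝓞 K ⧸ v.asIdeal) := by
    rw [Literature.NumberTheory.Automorphic.residueFieldCard_adicCompletion_eq,
      HeightOneSpectrum.residueCard_eq_card_quotient]
  have hfrob := (isArithFrobAt_absGaloisRestrict_adicCompletionPrime_iff K v hq τ).2 hτ
  have hinf := GaloisRep.cyclotomicCharacter_frob_not_isOfFinOrder (ℓ := p) hpv
    (adicCompletionPrime_mem_primesAbove K v) hfrob
  have hmem : absGaloisRestrict K (v.adicCompletion K) τ ∈ κ.kerSubgroup := h1
  rw [show κ.kerSubgroup = _ from hκ, Subgroup.mem_comap] at hmem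
  exact hinf ((CommGroup.mem_torsion _).1 hmem)

end Cyclotomic

end Summit.BirchSwinnertonDyer.Rank1Residual.Iwasawa

end
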